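import Summits.CriticalPhenomena.SAWScalingLimit.Theorems.SAWDefectDecoherenceBoundaryClosureRInnerPolygonsHalfLattice
import Literature.Probability.Percolation.TriLatticeCells
import Literature.Probability.RandomPlanarGeometry.HexSAWLattice
import HarnessLib

/-!
# Crux `BoundaryClosureR` (stmt-CriticalPhenomena-14004), line `polygon-parity-squeeze`,
# stub `stub_innerPolygons` (IP): the six closed cells round a lattice vertex are the six
# zigzag wedges (dictionary `triCell` ↔ `halfPlane`)

Landing target:
`Summits/CriticalPhenomena/SAWScalingLimit/Theorems/SAWDefectDecoherenceBoundaryClosureRInnerPolygonsLocalCells.lean`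
(`--supports stmt-CriticalPhenomena-14004`; building block of the registered stub `stub_innerPolygons`).

The inner exact polygon `P` is the inside of the boundary cycle of a pinch-free union `K` of closed
triangles of a coarse triangular grid; `ExactPolygonFamily P Λ^P` asks that near every boundary point
`P` be a zigzag half-plane or the intersection / union of two (`halfPlane k z`, inner normals
`innerNormal k`).  The bridge between the two languages is local: near a lattice vertex `y` the closed
cells present are exactly the closed `60°`-WEDGES at `y` of the faces of `K` round `y`.  This file
proves that dictionary for the unit lattice `𝕋 = triEmbed (Site 2)` (cells `triCell F` of
`Literature/Probability/Percolation/TriLatticeCells.lean`, lattice coordinates `triX`, `triY`):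

* `level_eq_triX`, `level_eq_triY`, `level_eq_triX_add_triY` (and the three negatives) — the signed
  levels `Re(z · conj n_k)` of the six forms ARE the lattice coordinates: `(√3/2)·X`, `(√3/2)·Y`,
  `(√3/2)·(X + Y)` up to sign; so grid lines are level lines and grid vertices sit at levels
  `(√3/2)·ℤ` (`level_triEmbed`);
* `cellForm_vertexFace` — the barycentric forms of the six faces round `y`
  (`(y;0), (y-e₀;1), (y-e₀;0), (y-e₀-e₁;1), (y-e₁;0), (y-e₁;1)`, anticlockwise, the face `k` spanning
  the directions `[k·60°, (k+1)·60°]`) in the relative coordinates `X' = X - y₀`, `Y' = Y - y₁`;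
* `mem_triCell_vertexFace_iff` — **within distance `1/4` of the vertex, membership in the `k`-th
  cell is membership in the `k`-th closed wedge** `{0 ≤ X', 0 ≤ Y'}`, `{X' ≤ 0 ≤ X'+Y'}`,
  `{X'+Y' ≤ 0 ≤ Y'}`, `{X' ≤ 0, Y' ≤ 0}`, `{X'+Y' ≤ 0 ≤ X'}`, `{Y' ≤ 0 ≤ X'+Y'}`;
* `vertexFace_of_mem_triCell` — **every cell meeting that ball is one of the six**.

Sources: folklore planar geometry of the triangular lattice (lattice coordinates).  No definition and
no named fact is introduced.
-/

noncomputable section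

open scoped ComplexConjugate
open Literature.Probability.LatticeModels
open Literature.Probability.Percolation (triX triY triCell cellForm triX_triEmbed triY_triEmbed
  abs_triX_sub_le abs_triY_sub_le mem_triCell_iff)
open Literature.Probability.RandomPlanarGeometry.SAW (site_two_eq_iff)

namespace Summit.CriticalPhenomena.SAWScalingLimit.Theorems.PolygonParitySqueeze

/-! ### 1. Levels are lattice coordinates -/

/-- `Re(z · conj n₂) = (√3/2)·X(z)` (form `2`, inner normal `e^{-iπ/6}`). [folklore] -/
theorem level_eq_triX (z : ℂ) : (z * conj (innerNormal 2)).re = Real.sqrt 3 / 2 * triX z := by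
  have h3 : Real.sqrt 3 ≠ 0 := by positivity
  have h33 : Real.sqrt 3 * Real.sqrt 3 = 3 := Real.mul_self_sqrt (by norm_num)
  simp only [innerNormal_eq, Matrix.cons_val, Complex.mul_re, Complex.conj_re, Complex.conj_im]
  unfold triX
  field_simp

/-- `Re(z · conj n₀) = (√3/2)·Y(z)` (form `0`, inner normal `i`). [folklore] -/
theorem level_eq_triY (z : ℂ) : (z * conj (innerNormal 0)).re = Real.sqrt 3 / 2 * triY z := by
  have h3 : Real.sqrt 3 ≠ 0 := by positivity
  simp only [innerNormal_eq, Matrix.cons_val_zero, Complex.mul_re, Complex.conj_re, Complex.conj_im,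
    Complex.I_re, Complex.I_im]
  unfold triY
  field_simp
  ring

/-- `Re(z · conj n₄) = (√3/2)·(X(z) + Y(z))` (form `4`, inner normal `e^{iπ/6}`). [folklore] -/
theorem level_eq_triX_add_triY (z : ℂ) :
    (z * conj (innerNormal 4)).re = Real.sqrt 3 / 2 * (triX z + triY z) := by
  have h3 : Real.sqrt 3 ≠ 0 := by positivity
  have h33 : Real.sqrt 3 * Real.sqrt 3 = 3 := Real.mul_self_sqrt (by norm_num)
  simp only [innerNormal_eq, Matrix.cons_val, Complex.mul_re, Complex.conj_re, Complex.conj_im]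
  unfold triX triY
  field_simp
  nlinarith [h33]

/-- The odd forms are the negatives of the even ones: `Re(z · conj n_{2i+1}) = -Re(z · conj n_{2i})`.
[folklore] -/
theorem level_odd_eq_neg (z : ℂ) :
    (z * conj (innerNormal 1)).re = -(z * conj (innerNormal 0)).re ∧
    (z * conj (innerNormal 3)).re = -(z * conj (innerNormal 2)).re ∧
    (z * conj (innerNormal 5)).re = -(z * conj (innerNormal 4)).re := by
  refine ⟨?_, ?_, ?_⟩ <;> simp [innerNormal, map_neg, mul_neg, Complex.neg_re]

/-- **Grid vertices sit on integral level lines**: the levels of `triEmbed x` are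
`(√3/2)·x₁`, `(√3/2)·x₀`, `(√3/2)·(x₀ + x₁)` for the forms `0, 2, 4`. [folklore] -/
theorem level_triEmbed (x : Site 2) :
    (triEmbed x * conj (innerNormal 0)).re = Real.sqrt 3 / 2 * x 1 ∧
    (triEmbed x * conj (innerNormal 2)).re = Real.sqrt 3 / 2 * x 0 ∧
    (triEmbed x * conj (innerNormal 4)).re = Real.sqrt 3 / 2 * (x 0 + x 1) := by
  rw [level_eq_triY, level_eq_triX, level_eq_triX_add_triY, triX_triEmbed, triY_triEmbed]
  exact ⟨rfl, rfl, by ring⟩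

/-! ### 2. The six cells round a vertex -/

/-- **Barycentric forms of the six faces round the vertex `y`**, in the relative lattice coordinates
`X' = X(z) - y₀`, `Y' = Y(z) - y₁`: face `0 = (y;0)`: `1-(X'+Y'), X', Y'`; `1 = (y-e₀;1)`:
`1-Y', X'+Y', -X'`; `2 = (y-e₀;0)`: `-(X'+Y'), X'+1, Y'`; `3 = (y-e₀-e₁;1)`: `-Y', X'+Y'+1, -X'`;
`4 = (y-e₁;0)`: `-(X'+Y'), X', Y'+1`; `5 = (y-e₁;1)`: `-Y', X'+Y', 1-X'`. [folklore] -/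
theorem cellForm_vertexFace (y : Site 2) (z : ℂ) :
    (cellForm (y, 0) 0 z = 1 - ((triX z - y 0) + (triY z - y 1)) ∧
      cellForm (y, 0) 1 z = triX z - y 0 ∧ cellForm (y, 0) 2 z = triY z - y 1) ∧
    (cellForm (y - Pi.single 0 1, 1) 0 z = 1 - (triY z - y 1) ∧
      cellForm (y - Pi.single 0 1, 1) 1 z = (triX z - y 0) + (triY z - y 1) ∧
      cellForm (y - Pi.single 0 1, 1) 2 z = -(triX z - y 0)) ∧
    (cellForm (y - Pi.single 0 1, 0) 0 z = -((triX z - y 0) + (triY z - y 1)) ∧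
      cellForm (y - Pi.single 0 1, 0) 1 z = (triX z - y 0) + 1 ∧
      cellForm (y - Pi.single 0 1, 0) 2 z = triY z - y 1) ∧
    (cellForm (y - Pi.single 0 1 - Pi.single 1 1, 1) 0 z = -(triY z - y 1) ∧
      cellForm (y - Pi.single 0 1 - Pi.single 1 1, 1) 1 z = (triX z - y 0) + (triY z - y 1) + 1 ∧
      cellForm (y - Pi.single 0 1 - Pi.single 1 1, 1) 2 z = -(triX z - y 0)) ∧
    (cellForm (y - Pi.single 1 1, 0) 0 z = -((triX z - y 0) + (triY z - y 1)) ∧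
      cellForm (y - Pi.single 1 1, 0) 1 z = triX z - y 0 ∧
      cellForm (y - Pi.single 1 1, 0) 2 z = (triY z - y 1) + 1) ∧
    (cellForm (y - Pi.single 1 1, 1) 0 z = -(triY z - y 1) ∧
      cellForm (y - Pi.single 1 1, 1) 1 z = (triX z - y 0) + (triY z - y 1) ∧
      cellForm (y - Pi.single 1 1, 1) 2 z = 1 - (triX z - y 0)) := by
  refine ⟨⟨?_, ?_, ?_⟩, ⟨?_, ?_, ?_⟩, ⟨?_, ?_, ?_⟩, ⟨?_, ?_, ?_⟩, ⟨?_, ?_, ?_⟩, ⟨?_, ?_, ?_⟩⟩ <;>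
    simp [cellForm] <;> ring

/-! ### 3. Near the vertex, cells are wedges -/

/-- Within distance `1/4` of the vertex `y` the relative lattice coordinates are smaller than `1/2`.
[folklore] -/
theorem abs_rel_coords_lt (y : Site 2) (z : ℂ) (hz : ‖z - triEmbed y‖ < 1 / 4) :
    |triX z - y 0| < 1 / 2 ∧ |triY z - y 1| < 1 / 2 := by
  have h1 := abs_triX_sub_le z (triEmbed y)
  have h2 := abs_triY_sub_le z (triEmbed y)
  rw [triX_triEmbed] at h1
  rw [triY_triEmbed] at h2
  constructor <;> linarith

/-- **Near a vertex, the six cells are the six closed wedges**: within distance `1/4` of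
`triEmbed y`, membership in the `k`-th cell round `y` is the pair of sign conditions of the `k`-th
closed `60°` wedge in the relative lattice coordinates `X' = X(z) - y₀`, `Y' = Y(z) - y₁` — by
`level_eq_triX/triY/…` these are the closed half-planes of the forms `(2,0), (3,4), (5,0), (3,1),
(2,5), (4,1)` through `triEmbed y`. [folklore] -/
theorem mem_triCell_vertexFace_iff (y : Site 2) (z : ℂ) (hz : ‖z - triEmbed y‖ < 1 / 4) :
    (z ∈ triCell (y, 0) ↔ 0 ≤ triX z - y 0 ∧ 0 ≤ triY z - y 1) ∧
    (z ∈ triCell (y - Pi.single 0 1, 1) ↔ triX z - y 0 ≤ 0 ∧ 0 ≤ (triX z - y 0) + (triY z - y 1)) ∧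
    (z ∈ triCell (y - Pi.single 0 1, 0) ↔ (triX z - y 0) + (triY z - y 1) ≤ 0 ∧ 0 ≤ triY z - y 1) ∧
    (z ∈ triCell (y - Pi.single 0 1 - Pi.single 1 1, 1) ↔ triX z - y 0 ≤ 0 ∧ triY z - y 1 ≤ 0) ∧
    (z ∈ triCell (y - Pi.single 1 1, 0) ↔ 0 ≤ triX z - y 0 ∧ (triX z - y 0) + (triY z - y 1) ≤ 0) ∧
    (z ∈ triCell (y - Pi.single 1 1, 1) ↔ triY z - y 1 ≤ 0 ∧ 0 ≤ (triX z - y 0) + (triY z - y 1)) := by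
  obtain ⟨hX, hY⟩ := abs_rel_coords_lt y z hz
  obtain ⟨hX1, hX2⟩ := abs_lt.1 hX
  obtain ⟨hY1, hY2⟩ := abs_lt.1 hY
  obtain ⟨⟨a0, a1, a2⟩, ⟨b0, b1, b2⟩, ⟨c0, c1, c2⟩, ⟨d0, d1, d2⟩, ⟨e0, e1, e2⟩, ⟨f0, f1, f2⟩⟩ :=
    cellForm_vertexFace y z
  have forall3 : ∀ {Q : Fin 3 → Prop}, (∀ j, Q j) ↔ Q 0 ∧ Q 1 ∧ Q 2 :=
    ⟨fun h => ⟨h 0, h 1, h 2⟩, fun h j => by fin_cases j <;> simp [h.1, h.2.1, h.2.2]⟩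
  simp only [mem_triCell_iff, forall3, a0, a1, a2, b0, b1, b2, c0, c1, c2, d0, d1, d2, e0, e1,
    e2, f0, f1, f2]
  refine ⟨?_, ?_, ?_, ?_, ?_, ?_⟩ <;> constructor <;> intro h
  · exact ⟨h.2.1, h.2.2⟩
  · exact ⟨by linarith, h.1, h.2⟩
  · exact ⟨by linarith, h.2.1⟩
  · exact ⟨by linarith, h.2, by linarith⟩
  · exact ⟨by linarith, h.2.2⟩
  · exact ⟨by linarith, by linarith, h.2⟩
  · exact ⟨by linarith, by linarith⟩
  · exact ⟨by linarith, by linarith, by linarith⟩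
  · exact ⟨h.2.1, by linarith⟩
  · exact ⟨by linarith, h.1, by linarith⟩
  · exact ⟨by linarith, h.2.1⟩
  · exact ⟨by linarith, h.2, by linarith⟩

/-- Integers: `a < b + t` with `t ≤ 1` forces `a ≤ b`. [folklore] -/
theorem int_le_of_lt_add_half {a b : ℤ} {t : ℝ} (ht : t ≤ 1) (h : (a : ℝ) < b + t) : a ≤ b := by
  by_contra hab
  have : b + 1 ≤ a := by omega
  have : ((b : ℝ)) + 1 ≤ a := by exact_mod_cast this
  linarith

/-- **Every cell meeting the `1/4`-ball about a vertex is one of the six cells round it.**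
[folklore] -/
theorem vertexFace_of_mem_triCell (y : Site 2) (z : ℂ) (hz : ‖z - triEmbed y‖ < 1 / 4) (F : HexVertex)
    (hF : z ∈ triCell F) :
    F = (y, 0) ∨ F = (y - Pi.single 0 1, 1) ∨ F = (y - Pi.single 0 1, 0) ∨
      F = (y - Pi.single 0 1 - Pi.single 1 1, 1) ∨ F = (y - Pi.single 1 1, 0) ∨ F = (y - Pi.single 1 1, 1) := by
  obtain ⟨hX, hY⟩ := abs_rel_coords_lt y z hz
  obtain ⟨hX1, hX2⟩ := abs_lt.1 hX
  obtain ⟨hY1, hY2⟩ := abs_lt.1 hY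
  obtain ⟨c, t⟩ := F
  have forall3 : ∀ {Q : Fin 3 → Prop}, (∀ j, Q j) ↔ Q 0 ∧ Q 1 ∧ Q 2 :=
    ⟨fun h => ⟨h 0, h 1, h 2⟩, fun h j => by fin_cases j <;> simp [h.1, h.2.1, h.2.2]⟩
  rw [mem_triCell_iff, forall3] at hF
  fin_cases t
  · simp [cellForm] at hF
    obtain ⟨h0, h1, h2⟩ := hF
    have i1 : c 0 ≤ y 0 := int_le_of_lt_add_half (t := 1 / 2) (by norm_num) (by linarith)
    have i2 : c 1 ≤ y 1 := int_le_of_lt_add_half (t := 1 / 2) (by norm_num) (by linarith)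
    have i3 : y 0 + y 1 - 1 ≤ c 0 + c 1 :=
      int_le_of_lt_add_half (a := y 0 + y 1 - 1) (b := c 0 + c 1) (t := 1) le_rfl (by push_cast; linarith)
    have key : (c 0 = y 0 ∧ c 1 = y 1) ∨ (c 0 = y 0 - 1 ∧ c 1 = y 1) ∨ (c 0 = y 0 ∧ c 1 = y 1 - 1) := by omega
    rcases key with h | h | h
    · exact Or.inl (by simp [Prod.ext_iff, site_two_eq_iff, h.1, h.2])
    · exact Or.inr (Or.inr (Or.inl (by simp [Prod.ext_iff, site_two_eq_iff, h.1, h.2])))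
    · exact Or.inr (Or.inr (Or.inr (Or.inr (Or.inl (by simp [Prod.ext_iff, site_two_eq_iff, h.1, h.2])))))
  · simp [cellForm] at hF
    obtain ⟨h0, h1, h2⟩ := hF
    have i1 : y 1 - 1 ≤ c 1 := int_le_of_lt_add_half (t := 1 / 2) (by norm_num) (by push_cast; linarith)
    have i2 : y 0 - 1 ≤ c 0 := int_le_of_lt_add_half (t := 1 / 2) (by norm_num) (by push_cast; linarith)
    have i3 : c 0 + c 1 ≤ y 0 + y 1 - 1 :=
      int_le_of_lt_add_half (a := c 0 + c 1) (b := y 0 + y 1 - 1) (t := 1) le_rfl (by push_cast; linarith)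
    have key : (c 0 = y 0 - 1 ∧ c 1 = y 1) ∨ (c 0 = y 0 ∧ c 1 = y 1 - 1) ∨ (c 0 = y 0 - 1 ∧ c 1 = y 1 - 1) := by
      omega
    rcases key with h | h | h
    · exact Or.inr (Or.inl (by simp [Prod.ext_iff, site_two_eq_iff, h.1, h.2]))
    · exact Or.inr (Or.inr (Or.inr (Or.inr (Or.inr (by simp [Prod.ext_iff, site_two_eq_iff, h.1, h.2])))))
    · exact Or.inr (Or.inr (Or.inr (Or.inl (by simp [Prod.ext_iff, site_two_eq_iff, h.1, h.2]))))

/-- **The six cells round a vertex are the six zigzag wedges** (registered form, sub-goal of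
`stub_innerPolygons`): within distance `1/4` of `triEmbed y`, membership in each of the six cells
round `y` is the pair of sign conditions of its closed `60°` wedge, and no other cell is met.
[folklore] -/
theorem vertexCells_are_wedges : ∀ (y : Site 2) (z : ℂ), ‖z - triEmbed y‖ < 1 / 4 → ((z ∈ triCell (y, 0) ↔ 0 ≤ triX z - y 0 ∧ 0 ≤ triY z - y 1) ∧ (z ∈ triCell (y - Pi.single 0 1, 1) ↔ triX z - y 0 ≤ 0 ∧ 0 ≤ (triX z - y 0) + (triY z - y 1)) ∧ (z ∈ triCell (y - Pi.single 0 1, 0) ↔ (triX z - y 0) + (triY z - y 1) ≤ 0 ∧ 0 ≤ triY z - y 1) ∧ (z ∈ triCell (y - Pi.single 0 1 - Pi.single 1 1, 1) ↔ triX z - y 0 ≤ 0 ∧ triY z - y 1 ≤ 0) ∧ (z ∈ triCell (y - Pi.single 1 1, 0) ↔ 0 ≤ triX z - y 0 ∧ (triX z - y 0) + (triY z - y 1) ≤ 0) ∧ (z ∈ triCell (y - Pi.single 1 1, 1) ↔ triY z - y 1 ≤ 0 ∧ 0 ≤ (triX z - y 0) + (triY z - y 1))) ∧ ∀ F : HexVertex,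 z ∈ triCell F → F = (y, 0) ∨ F = (y - Pi.single 0 1, 1) ∨ F = (y - Pi.single 0 1, 0) ∨ F = (y - Pi.single 0 1 - Pi.single 1 1, 1) ∨ F = (y - Pi.single 1 1, 0) ∨ F = (y - Pi.single 1 1, 1) := by
  intro y z hz
  exact ⟨mem_triCell_vertexFace_iff y z hz, vertexFace_of_mem_triCell y z hz⟩

end Summit.CriticalPhenomena.SAWScalingLimit.Theorems.PolygonParitySqueeze

end
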